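import Summits.BirchSwinnertonDyer.BirchSwinnertonDyer.Theorems.ThetaPartnerAtTwoSignedKatoUpToAtTwoIwasawaInvolutionCompat
import Literature.NumberTheory.EllipticCurves.IwasawaSelmerProofs
import HarnessLib

/-!
# The `γ ↦ γ⁻¹` twist of the PLAIN dual Selmer data `W.SelmerDualData κ γ` (`X(E/K_∞) = Sel_{p^∞}(E/K_∞)^∨`)
# is its Iwasawa-involution twist — ticket T-TWIST-SEL-1 (`exists_twist_selmerDualData_invol`)

Seat `bsd-2adic-tower-1` GEN 19 (cell `bsd-2adic`; K4 route `ByReductionTypeAtTwo`, items 19271 / 19573 good-ordinary Kato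
road, 19922 / 19923 multiplicative END doors). HONEST FRAMING: THEOREMS ONLY — no definition, no named fact, no instance, no
`sorry`; route-independent (no `Theses` import); closes no item; BSD is NOT proved by any of this.

## Why this file

The print-exact twins of Kato's §17.13 ∃-packages (`Literature/…/Kato2004/DivisibilityInputsContragredient.lean`, ticket
T-ι-TWINS-1, p604443) bind the dual Selmer datum in its CONTRAGREDIENT `Λ`-structure, `D : W.SelmerDualData κ γ⁻¹`, against
the covariant `I : Kato2004.IwasawaH1Data W p κ γ`; every END theorem of the tree is stated for `D : W.SelmerDualData κ γ`
with `γ` the chosen (normalised) topological generator. Re-keying an END theorem to the twins therefore needs the twist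
`γ ↦ γ⁻¹` of PLAIN dual Selmer data together with its effect on torsion-ness, the characteristic ideal and the local
lengths — exactly what `…ThetaPartnerAtTwoSignedKatoUpToAtTwoIwasawaInvolutionTwist` / `…Compat` (cell `bsd-wall`) proved
for the SIGNED data `Kobayashi2003.SignedSelmerDualData` and Kato's FINE data `W.FineSelmerDualData`. This file is the
third member of that family, for `W.SelmerDualData` (`Literature/…/IwasawaSelmer.lean`), with the same statements and the
same proofs (pure algebra: `(1+T)` is a unit of `Λ`, `conj` is an action, `Sel_∞` is `conj`-stable by the PROVED
`WeierstrassCurve.map_conjH1_selmerGroupOver_le_holds`), plus the finiteness transport `Module.Finite` (needed because the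
tree's finiteness theorem `SelmerDualData.module_finite_of_isCyclotomic` wants a NORMALISED generator, which `γ⁻¹` is not).

## What is proved (abstract `ι` with `ι f = f(T^ι)`, `T^ι = (1+T)⁻¹ − 1`, then the named `IwasawaAlgebra.invol p`)

* §1 `selmer_toDual_invol_one_add_X_smul` (in `D : W.SelmerDualData κ γ` the unit `ι(1+T)` acts as `x ↦ x ∘ conj_δ`
  for `γδ = 1`), **`exists_twist_selmerDualData`** (`∃ D′ : W.SelmerDualData κ δ`, `e : D.X ≃+ D′.X` with
  `e (f • x) = ι f • e x` and `D′.toDual ∘ e = D.toDual`), `finite_iff_of_semilinear` (finiteness along a semilinear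
  additive isomorphism), **`exists_twist_selmerDualData_invariants`** (adds: torsion ⟺, `char(D′.X) = ι char(D.X)`,
  `ℓ_{ι𝔓}(D.X) = ℓ_𝔓(D′.X)`, `Module.Finite` ⟺).
* §2 **`exists_twist_selmerDualData_invol`** — the same for `ι = IwasawaAlgebra.involEquiv p` in the v5 spelling
  (`IwasawaAlgebra.invol p`, `PrimeSpectrum.comap (IwasawaAlgebra.invol p).toRingHom`), the literal analogue of
  `exists_twist_fineSelmerDualData_invol` (+ the finiteness conjunct, last), and the two specialisations
  `exists_twist_selmerDualData_invol_of_mul_inv` (`γ ↦ γ⁻¹`) / `…_of_inv_mul` (`γ⁻¹ ↦ γ`).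
* §3 (appended) `comap_involEquiv_augIdealP` (`ι_Λ` fixes `(p)`), **`muInvariant_eq_of_semilinear_invol`**,
  **`lambdaInvariant_eq_of_semilinear_invol`** (any `ι_Λ`-semilinear additive isomorphism preserves `μ` and `λ`),
  `mu_eq_and_lambda_eq_of_semilinear_invol`, `exists_twist_selmerDualData_invol_mu_lambda` (`D′.mu = D.mu`,
  `D′.lambda = D.lambda`).

References: [GreenbergLNM1716, §1 (pp. 60, 67–68: `S^ι`, functional equation)]; [Greenberg1989, §0 pp. 101–102 (`S^ι`)];
[Mazur1972, §6]; [Kato2004Asterisque, §17.3 (p. 273), §17.13 (p. 279)]; tree: `IwasawaSelmer` (`SelmerDualData.toDual_T_smul`),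
`IwasawaSelmerProofs` (`map_conjH1_selmerGroupOver_le_holds`), `…IwasawaInvolutionTwist` §1–§3, `…SemilinearTransport`.
-/

set_option autoImplicit false
-- the Theorems namespace of this sub repeats the summit name by design (D-0017 nested layout)
set_option linter.dupNamespace false

noncomputable section

open scoped Classical

namespace Summit.BirchSwinnertonDyer.BirchSwinnertonDyer.Theorems

namespace SignedKatoOffTwo.IwasawaInvolution

open PowerSeries Literature.NumberTheory.EllipticCurves Literature.NumberTheory.EllipticCurves.Module
  Literature.Barriers.BirchSwinnertonDyer

universe u

/-! ## §1 The `γ ↦ γ⁻¹` twist of `W.SelmerDualData κ γ` for an abstract involution `ι` -/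

section Twist

variable {K : Type u} [Field K] [NumberField K] {p : ℕ} [Fact p.Prime]
  {W : WeierstrassCurve K} {κ : ZpExtension K p} {γ δ : Field.absoluteGaloisGroup K}
  (ι : IwasawaAlgebra p ≃+* IwasawaAlgebra p)
  (hι : ∀ f : IwasawaAlgebra p, ι f = subst (invOnePlusSubOne : ℤ_[p]⟦X⟧) f)
include hι

/-- **KEY COMPUTATION** in a datum `D : W.SelmerDualData κ γ` (`T` acts as `x ↦ x ∘ conj_γ − x`): the unit
`ι(1+T) = (1+T)⁻¹` acts as `x ↦ x ∘ conj_δ` for `γ δ = 1` — because `1 + T` acts as `x ↦ x ∘ conj_γ` and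
`conj_γ ∘ conj_δ = conj_1 = id` (`conjH1_mul_holds`, `conjH1_one_holds`); `Sel_∞` is `conj_δ`-stable by
`map_conjH1_selmerGroupOver_le_holds`. Pure algebra; no continuity. [cite: GreenbergLNM1716, §1 (p. 60: the Λ-module X_E(F_∞))] -/
theorem selmer_toDual_invol_one_add_X_smul (hγδ : γ * δ = 1) (D : W.SelmerDualData κ γ) (x : D.X)
    (s : W.selmerInfty κ) :
    D.toDual (ι (1 + X) • x) s =
      D.toDual x ⟨W.conjH1 p κ.kerSubgroup δ s,
        W.map_conjH1_selmerGroupOver_le_holds p κ.kerSubgroup δ ⟨s, s.2, rfl⟩⟩ := by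
  set y : D.X := ι (1 + X) • x with hy
  have hx : x = (1 + X : IwasawaAlgebra p) • y := by
    rw [hy, ← mul_smul, one_add_X_mul_invol ι hι, one_smul]
  have h1 : ∀ s' : W.selmerInfty κ, D.toDual ((1 + X : IwasawaAlgebra p) • y) s' =
      D.toDual y ⟨W.conjH1 p κ.kerSubgroup γ s', D.conj_mem _ s'.2⟩ := by
    intro s'
    rw [add_smul, one_smul, map_add, AddMonoidHom.add_apply, D.toDual_T_smul, add_sub_cancel]
  conv_rhs => rw [hx, h1]
  congr 1
  apply Subtype.ext
  change (s : W.subgroupH1 p κ.kerSubgroup) =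
    W.conjH1 p κ.kerSubgroup γ (W.conjH1 p κ.kerSubgroup δ (s : W.subgroupH1 p κ.kerSubgroup))
  rw [← AddMonoidHom.comp_apply, ← W.conjH1_mul_holds p κ.kerSubgroup γ δ, hγδ,
    W.conjH1_one_holds p κ.kerSubgroup, AddMonoidHom.id_apply]

/-- **THE TWIST `γ ↦ γ⁻¹` OF A PLAIN DUAL SELMER DATUM IS ITS `ι`-TWIST.** For `γ δ = 1` and every datum
`D : W.SelmerDualData κ γ` (`X(E/K_∞)` with `T` acting through `conj_γ`) there is a datum `D′ : W.SelmerDualData κ δ`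
on the SAME character group (`D′.toDual ∘ e = D.toDual`) whose `Λ`-structure is the `ι`-twist: `e (f • x) = ι f • e x`.
(Construction: `D′.X := D.X` with `f •′ x := ι f • x`; `T •′ x = (ι(1+T) − 1) • x = x ∘ conj_δ − x` by
`selmer_toDual_invol_one_add_X_smul`; constants are fixed by `ι`; `conj_mem` for `δ` is the proved
`map_conjH1_selmerGroupOver_le_holds`.) In print the Pontryagin dual `X(T) = Hom(Sel_∞(T), F_λ/O_λ)` "regarded as a
module over `Λ` in the natural way" carries the contragredient action, i.e. is the tree's `δ = γ⁻¹` datum when `γ` is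
the chosen generator (Greenberg's `S^ι`). [cite: GreenbergLNM1716, §1 (pp. 60, 67–68)] [cite: Greenberg1989, §0 pp. 101–102 (S^ι)] -/
theorem exists_twist_selmerDualData (hγδ : γ * δ = 1) (D : W.SelmerDualData κ γ) :
    ∃ (D' : W.SelmerDualData κ δ) (e : D.X ≃+ D'.X),
      (∀ (f : IwasawaAlgebra p) (x : D.X), e (f • x) = ι f • e x) ∧
      ∀ x : D.X, D'.toDual (e x) = D.toDual x := by
  have hmem : ∀ s ∈ W.selmerInfty κ, W.conjH1 p κ.kerSubgroup δ s ∈ W.selmerInfty κ :=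
    fun s hs ↦ W.map_conjH1_selmerGroupOver_le_holds p κ.kerSubgroup δ ⟨s, hs, rfl⟩
  refine ⟨@WeierstrassCurve.SelmerDualData.mk K _ _ W p _ κ δ D.X D.addCommGroup
      (Module.compHom D.X (ι : IwasawaAlgebra p →+* IwasawaAlgebra p)) hmem D.toDual D.bijective ?_ ?_,
    AddEquiv.refl D.X, ?_, ?_⟩
  · intro x s
    change D.toDual (ι X • x) s = _
    rw [invol_X_eq_sub ι, sub_smul, one_smul, map_sub, AddMonoidHom.sub_apply,
      selmer_toDual_invol_one_add_X_smul ι hι hγδ D x s]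
  · intro c x s k hk
    change D.toDual (ι (C c) • x) s = _
    rw [invol_C ι hι]
    exact D.toDual_C_smul c x s k hk
  · intro f x
    change f • x = ι (ι f) • x
    rw [invol_invol ι hι]
  · intro x
    rfl

omit hι in
/-- **Finiteness is invariant under a semilinear isomorphism**: for an additive isomorphism `e : M ≃+ N` which is
`ι`-semilinear for a ring automorphism `ι` of `Λ`, `M` is a finitely generated `Λ`-module iff `N` is (Mathlib's
`LinearMap.finite_iff_of_bijective` for the `ι`-semilinear map `e`). [folklore] -/
theorem finite_iff_of_semilinear {M N : Type*} [AddCommGroup M] [Module (IwasawaAlgebra p) M]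
    [AddCommGroup N] [Module (IwasawaAlgebra p) N] (e : M ≃+ N)
    (he : ∀ (f : IwasawaAlgebra p) (x : M), e (f • x) = ι f • e x) :
    Module.Finite (IwasawaAlgebra p) M ↔ Module.Finite (IwasawaAlgebra p) N := by
  haveI : RingHomSurjective (ι : IwasawaAlgebra p →+* IwasawaAlgebra p) := ⟨ι.surjective⟩
  let f : M →ₛₗ[(ι : IwasawaAlgebra p →+* IwasawaAlgebra p)] N :=
    { toFun := e, map_add' := fun a b ↦ e.map_add a b, map_smul' := he }
  exact LinearMap.finite_iff_of_bijective f e.bijective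

/-- **The twisted datum and its invariants, packaged**: for `γ δ = 1` and `D : W.SelmerDualData κ γ` there is
`D′ : W.SelmerDualData κ δ` on the same character group with `Λ`-structure twisted by `ι`, and `D.X` torsion ⟺ `D′.X`
torsion, `char(D′.X) = ι(char(D.X))`, `ℓ_{ι𝔓}(D.X) = ℓ_𝔓(D′.X)` for every prime `𝔓` (`…SemilinearTransport`), `D.X`
finitely generated ⟺ `D′.X` finitely generated. [cite: GreenbergLNM1716, §1 (pp. 60, 67–68)] -/
theorem exists_twist_selmerDualData_invariants (hγδ : γ * δ = 1) (D : W.SelmerDualData κ γ) :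
    ∃ (D' : W.SelmerDualData κ δ) (e : D.X ≃+ D'.X),
      (∀ (f : IwasawaAlgebra p) (x : D.X), e (f • x) = ι f • e x) ∧
      (∀ x : D.X, D'.toDual (e x) = D.toDual x) ∧
      (Module.IsTorsion (IwasawaAlgebra p) D.X ↔ Module.IsTorsion (IwasawaAlgebra p) D'.X) ∧
      D'.charIdeal = D.charIdeal.map ι ∧
      (∀ 𝔓 : PrimeSpectrum (IwasawaAlgebra p),
        lengthAt (IwasawaAlgebra p) D.X ⟨𝔓.asIdeal.comap ι, inferInstance⟩ =
          lengthAt (IwasawaAlgebra p) D'.X 𝔓) ∧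
      (Module.Finite (IwasawaAlgebra p) D.X ↔ Module.Finite (IwasawaAlgebra p) D'.X) := by
  obtain ⟨D', e, he, hdual⟩ := exists_twist_selmerDualData ι hι hγδ D
  exact ⟨D', e, he, hdual, SemilinearTransport.isTorsion_iff_of_semilinear ι e he,
    SemilinearTransport.charIdeal_eq_map ι e he,
    fun 𝔓 ↦ SemilinearTransport.lengthAt_eq ι e he rfl, finite_iff_of_semilinear ι e he⟩

end Twist

/-! ## §2 The same in the v5 spelling `IwasawaAlgebra.invol p` (ticket T-TWIST-SEL-1) -/

section Named

variable {p : ℕ} [Fact p.Prime] {K : Type u} [Field K] [NumberField K] {W : WeierstrassCurve K}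
  {κ : ZpExtension K p} {γ δ : Field.absoluteGaloisGroup K}

/-- **T-TWIST-SEL-1 — the `γ ↦ γ⁻¹` twist of a PLAIN dual Selmer datum is its `IwasawaAlgebra.invol`-twist** (v5
spelling; the literal analogue of `exists_twist_fineSelmerDualData_invol` for `W.SelmerDualData`, with the finiteness
transport as a last conjunct): for `γ δ = 1` and `D : W.SelmerDualData κ γ` there are `D′ : W.SelmerDualData κ δ` and
`e : D.X ≃+ D′.X` with `e (f • x) = invol p f • e x`, `D′.toDual ∘ e = D.toDual`, `D.X` torsion ⟺ `D′.X` torsion,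
`char(D′.X) = invol(char(D.X))`, `ℓ_{ι𝔓}(D.X) = ℓ_𝔓(D′.X)` (`ι𝔓 = PrimeSpectrum.comap (invol p) 𝔓`), and `D.X` finitely
generated ⟺ `D′.X` finitely generated. [cite: GreenbergLNM1716, §1 (pp. 60, 67–68)] [cite: Greenberg1989, §0 pp. 101–102 (S^ι)] -/
theorem exists_twist_selmerDualData_invol (hγδ : γ * δ = 1) (D : W.SelmerDualData κ γ) :
    ∃ (D' : W.SelmerDualData κ δ) (e : D.X ≃+ D'.X),
      (∀ (f : IwasawaAlgebra p) (x : D.X), e (f • x) = IwasawaAlgebra.invol p f • e x) ∧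
      (∀ x : D.X, D'.toDual (e x) = D.toDual x) ∧
      (Module.IsTorsion (IwasawaAlgebra p) D.X ↔ Module.IsTorsion (IwasawaAlgebra p) D'.X) ∧
      D'.charIdeal = D.charIdeal.map (IwasawaAlgebra.invol p) ∧
      (∀ 𝔓 : PrimeSpectrum (IwasawaAlgebra p),
        lengthAt (IwasawaAlgebra p) D.X (PrimeSpectrum.comap (IwasawaAlgebra.invol p).toRingHom 𝔓) =
          lengthAt (IwasawaAlgebra p) D'.X 𝔓) ∧
      (Module.Finite (IwasawaAlgebra p) D.X ↔ Module.Finite (IwasawaAlgebra p) D'.X) := by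
  obtain ⟨D', e, he, hdual, htors, hchar, hlen, hfin⟩ :=
    exists_twist_selmerDualData_invariants _ (involEquiv_eq_subst p) hγδ D
  refine ⟨D', e, fun f x ↦ he f x, hdual, htors, ?_, fun 𝔓 ↦ ?_, hfin⟩
  · rw [hchar]
    rfl
  · rw [primeSpectrum_comap_invol_eq]
    exact hlen 𝔓

/-- The twist `γ ↦ γ⁻¹` (the case `δ = γ⁻¹` of `exists_twist_selmerDualData_invol`): from the tree's `γ`-datum to the
contragredient (print) datum `W.SelmerDualData κ γ⁻¹` of the T-ι-TWINS-1 packages. [cite: Kato2004Asterisque, §17.3 (p. 273) and §17.13 (p. 279)] -/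
theorem exists_twist_selmerDualData_invol_of_mul_inv (D : W.SelmerDualData κ γ) :
    ∃ (D' : W.SelmerDualData κ γ⁻¹) (e : D.X ≃+ D'.X),
      (∀ (f : IwasawaAlgebra p) (x : D.X), e (f • x) = IwasawaAlgebra.invol p f • e x) ∧
      (∀ x : D.X, D'.toDual (e x) = D.toDual x) ∧
      (Module.IsTorsion (IwasawaAlgebra p) D.X ↔ Module.IsTorsion (IwasawaAlgebra p) D'.X) ∧
      D'.charIdeal = D.charIdeal.map (IwasawaAlgebra.invol p) ∧
      (∀ 𝔓 : PrimeSpectrum (IwasawaAlgebra p),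
        lengthAt (IwasawaAlgebra p) D.X (PrimeSpectrum.comap (IwasawaAlgebra.invol p).toRingHom 𝔓) =
          lengthAt (IwasawaAlgebra p) D'.X 𝔓) ∧
      (Module.Finite (IwasawaAlgebra p) D.X ↔ Module.Finite (IwasawaAlgebra p) D'.X) :=
  exists_twist_selmerDualData_invol (mul_inv_cancel γ) D

/-- The twist `γ⁻¹ ↦ γ` (the case of `exists_twist_selmerDualData_invol` from a contragredient datum
`D′ : W.SelmerDualData κ γ⁻¹` back to the tree's convention). [cite: Kato2004Asterisque, §17.3 (p. 273) and §17.13 (p. 279)] -/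
theorem exists_twist_selmerDualData_invol_of_inv_mul (D' : W.SelmerDualData κ γ⁻¹) :
    ∃ (D : W.SelmerDualData κ γ) (e : D'.X ≃+ D.X),
      (∀ (f : IwasawaAlgebra p) (x : D'.X), e (f • x) = IwasawaAlgebra.invol p f • e x) ∧
      (∀ x : D'.X, D.toDual (e x) = D'.toDual x) ∧
      (Module.IsTorsion (IwasawaAlgebra p) D'.X ↔ Module.IsTorsion (IwasawaAlgebra p) D.X) ∧
      D.charIdeal = D'.charIdeal.map (IwasawaAlgebra.invol p) ∧
      (∀ 𝔓 : PrimeSpectrum (IwasawaAlgebra p),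
        lengthAt (IwasawaAlgebra p) D'.X (PrimeSpectrum.comap (IwasawaAlgebra.invol p).toRingHom 𝔓) =
          lengthAt (IwasawaAlgebra p) D.X 𝔓) ∧
      (Module.Finite (IwasawaAlgebra p) D'.X ↔ Module.Finite (IwasawaAlgebra p) D.X) :=
  exists_twist_selmerDualData_invol (inv_mul_cancel γ) D'

end Named

/-! ## §3 (appended, GEN 19) `μ` and `λ` are unchanged by the `ι`-twist

The audit word «`μ` is `ι`-invariant» (bsd-cited ARM-P R-48 / I-ι-2) as kernel theorems: an additive isomorphism
`e : M ≃+ N` that is `IwasawaAlgebra.invol p`-semilinear preserves `μ` (the local length at `(p)`, a prime FIXED by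
`ι_Λ` because `ι_Λ` fixes constants) and `λ` (`dim_{ℚ_p} M ⊗ ℚ_p`: `e` is `ℤ_p`-linear because `ι_Λ` is a
`ℤ_p`-algebra map). For the twisted dual Selmer data of §2 this gives `D′.mu = D.mu`, `D′.lambda = D.lambda`. -/

section MuLambda

variable {p : ℕ} [Fact p.Prime]

/-- `ι_Λ` fixes the prime `(p) ⊂ Λ`: `(p).comap ι_Λ = (p)` (`ι_Λ` is an involution fixing the constant `p`).
[folklore] -/
theorem comap_involEquiv_augIdealP :
    (IwasawaAlgebra.augIdealP p).comap
        (IwasawaAlgebra.involEquiv p : IwasawaAlgebra p ≃+* IwasawaAlgebra p) =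
      IwasawaAlgebra.augIdealP p := by
  have hC : IwasawaAlgebra.invol p (C (p : ℤ_[p])) = C (p : ℤ_[p]) := IwasawaAlgebra.invol_C p _
  ext x
  simp only [Ideal.mem_comap, IwasawaAlgebra.augIdealP, Ideal.mem_span_singleton']
  constructor
  · rintro ⟨r, hr⟩
    refine ⟨IwasawaAlgebra.invol p r, ?_⟩
    have h := congrArg (IwasawaAlgebra.invol p) hr
    rw [map_mul, hC] at h
    rw [h]
    exact IwasawaAlgebra.invol_invol p x
  · rintro ⟨r, rfl⟩
    exact ⟨IwasawaAlgebra.invol p r, by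
      change _ = IwasawaAlgebra.invol p (r * C (p : ℤ_[p]))
      rw [map_mul, hC]⟩

/-- **`μ` is invariant under an `ι_Λ`-semilinear isomorphism**: `μ(M) = μ(N)` for `e : M ≃+ N` additive with
`e (f • x) = ι_Λ f • e x` — `μ` is the local length at `(p)` (`muInvariant_eq_toNat_lengthAt`), lengths are transported
to the `ι_Λ`-corresponding prime (`SemilinearTransport.lengthAt_eq`), and `(p)` corresponds to itself
(`comap_involEquiv_augIdealP`). [cite: GreenbergLNM1716, §1 (pp. 60, 67–68)] -/
theorem muInvariant_eq_of_semilinear_invol {M N : Type*} [AddCommGroup M] [Module (IwasawaAlgebra p) M]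
    [AddCommGroup N] [Module (IwasawaAlgebra p) N] (e : M ≃+ N)
    (he : ∀ (f : IwasawaAlgebra p) (x : M), e (f • x) = IwasawaAlgebra.invol p f • e x) :
    muInvariant p M = muInvariant p N := by
  let 𝔭 : PrimeSpectrum (IwasawaAlgebra p) :=
    ⟨IwasawaAlgebra.augIdealP p, IwasawaAlgebra.isPrime_augIdealP_holds p⟩
  -- `(p)` corresponds to itself under `ι_Λ`, so the transported length is the length at `(p)` again
  have hlen : lengthAt (IwasawaAlgebra p) M 𝔭 = lengthAt (IwasawaAlgebra p) N 𝔭 :=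
    SemilinearTransport.lengthAt_eq
      (IwasawaAlgebra.involEquiv p : IwasawaAlgebra p ≃+* IwasawaAlgebra p) e (fun f x ↦ he f x)
      (𝔭 := 𝔭) (𝔓 := 𝔭) comap_involEquiv_augIdealP.symm
  rw [muInvariant_eq_toNat_lengthAt p M 𝔭 rfl, muInvariant_eq_toNat_lengthAt p N 𝔭 rfl, hlen]

/-- **`λ` is invariant under an `ι_Λ`-semilinear isomorphism**: `λ(M) = λ(N)` for `e : M ≃+ N` additive with
`e (f • x) = ι_Λ f • e x` — `ι_Λ` is a `ℤ_p`-algebra map, so `e` is `ℤ_p`-linear on the underlying `ℤ_p`-modules and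
base-changes to a `ℚ_p`-linear equivalence `M ⊗ ℚ_p ≃ N ⊗ ℚ_p`. [cite: GreenbergLNM1716, §1 (pp. 60, 67–68)] -/
theorem lambdaInvariant_eq_of_semilinear_invol {M N : Type*} [AddCommGroup M] [Module (IwasawaAlgebra p) M]
    [AddCommGroup N] [Module (IwasawaAlgebra p) N] (e : M ≃+ N)
    (he : ∀ (f : IwasawaAlgebra p) (x : M), e (f • x) = IwasawaAlgebra.invol p f • e x) :
    lambdaInvariant p M = lambdaInvariant p N := by
  let e' : RestrictScalars ℤ_[p] (IwasawaAlgebra p) M ≃ₗ[ℤ_[p]]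
      RestrictScalars ℤ_[p] (IwasawaAlgebra p) N :=
    { ((RestrictScalars.addEquiv ℤ_[p] (IwasawaAlgebra p) M).trans e).trans
        (RestrictScalars.addEquiv ℤ_[p] (IwasawaAlgebra p) N).symm with
      map_smul' := fun c x ↦ by
        change e ((algebraMap ℤ_[p] (IwasawaAlgebra p) c) •
            (RestrictScalars.addEquiv ℤ_[p] (IwasawaAlgebra p) M x)) =
          (algebraMap ℤ_[p] (IwasawaAlgebra p) c) • e (RestrictScalars.addEquiv ℤ_[p] (IwasawaAlgebra p) M x)
        rw [he, (IwasawaAlgebra.invol p).commutes c] }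
  unfold lambdaInvariant
  exact (e'.baseChange ℤ_[p] ℚ_[p] _ _).finrank_eq

variable {K : Type u} [Field K] [NumberField K] {W : WeierstrassCurve K} {κ : ZpExtension K p}
  {γ δ : Field.absoluteGaloisGroup K}

/-- **The twisted dual Selmer datum has the same `μ`- and `λ`-invariant**: for `D : W.SelmerDualData κ γ`,
`D′ : W.SelmerDualData κ δ` and an `ι_Λ`-semilinear `e : D.X ≃+ D′.X` (as produced by `exists_twist_selmerDualData_invol`),
`D′.mu = D.mu` and `D′.lambda = D.lambda`. [cite: GreenbergLNM1716, §1 (pp. 60, 67–68)] [cite: Greenberg1989, §0 pp. 101–102 (S^ι)] -/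
theorem mu_eq_and_lambda_eq_of_semilinear_invol (D : W.SelmerDualData κ γ) (D' : W.SelmerDualData κ δ)
    (e : D.X ≃+ D'.X) (he : ∀ (f : IwasawaAlgebra p) (x : D.X), e (f • x) = IwasawaAlgebra.invol p f • e x) :
    D'.mu = D.mu ∧ D'.lambda = D.lambda :=
  ⟨(muInvariant_eq_of_semilinear_invol e he).symm, (lambdaInvariant_eq_of_semilinear_invol e he).symm⟩

/-- **T-TWIST-SEL-1 with `μ` and `λ`**: for `γ δ = 1` and `D : W.SelmerDualData κ γ` there is a twisted datum
`D′ : W.SelmerDualData κ δ` (as in `exists_twist_selmerDualData_invol`: same character group, `Λ` through `ι_Λ`,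
torsion ⟺, `char(D′) = ι_Λ char(D)`) with, moreover, `D′.mu = D.mu` and `D′.lambda = D.lambda`.
[cite: GreenbergLNM1716, §1 (pp. 60, 67–68)] [cite: Greenberg1989, §0 pp. 101–102 (S^ι)] -/
theorem exists_twist_selmerDualData_invol_mu_lambda (hγδ : γ * δ = 1) (D : W.SelmerDualData κ γ) :
    ∃ (D' : W.SelmerDualData κ δ) (e : D.X ≃+ D'.X),
      (∀ (f : IwasawaAlgebra p) (x : D.X), e (f • x) = IwasawaAlgebra.invol p f • e x) ∧
      (∀ x : D.X, D'.toDual (e x) = D.toDual x) ∧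
      (Module.IsTorsion (IwasawaAlgebra p) D.X ↔ Module.IsTorsion (IwasawaAlgebra p) D'.X) ∧
      D'.charIdeal = D.charIdeal.map (IwasawaAlgebra.invol p) ∧
      D'.mu = D.mu ∧ D'.lambda = D.lambda := by
  obtain ⟨D', e, he, hdual, htors, hchar, -, -⟩ := exists_twist_selmerDualData_invol (p := p) hγδ D
  exact ⟨D', e, he, hdual, htors, hchar, mu_eq_and_lambda_eq_of_semilinear_invol D D' e he⟩

end MuLambda

end SignedKatoOffTwo.IwasawaInvolution

end Summit.BirchSwinnertonDyer.BirchSwinnertonDyer.Theorems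

end
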